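import Summits.MatrixMultiplication.MatrixMultiplication.Theorems.AbelianSTPPCensusShapeCertVPDefs

/-!
# Abelian STPP census — kernel evaluation of the vP certificate checker `ShapeCertVP` (E: orders 255–279)

Cell mm-stpp, route `AbelianSTPPCensusVP`, crux `ShapeExclusionVP337` (stmt-MatrixMultiplication-19191); support file
(no definitions).  `ShapeCertVP.checkV M = true` by `decide +kernel` (no `native_decide`, standard axioms), ONE theorem
per order so that every kernel evaluation starts with empty caches (measured in the seat folder: ≈ 4–8 s per order below
300, ≤ 35 s at the orders 300–337 — candidate-list construction plus the `feasP` packings of the visited nodes);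
`Elab.async false` keeps the evaluations of this file sequential (one kernel computation in memory at a time; tree
precedent `NeelSignC23EK0Cert4`).  The range lemma `checkV_255_279` at the end collects the file; the ten ranges are
assembled on `128 ≤ M ≤ 337` in `AbelianSTPPCensusVPShapeExclusionVP337.lean`, where `ShapeCertVP.checkV_sound`
(`…ShapeCertVPSearch`) and the bridge `ShapeCertVP.shapeExclusionVP_of_checkV` (`…ShapeCertVPFinal`) turn them into
the crux.
-/

set_option linter.dupNamespace false -- `MatrixMultiplication.MatrixMultiplication` (summit = problem, D-0017)
set_option autoImplicit false
set_option Elab.async false -- sequential kernel evaluations (memory high-water of one order at a time)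

namespace Summit.MatrixMultiplication.MatrixMultiplication.Theorems.ShapeCertVP

set_option maxHeartbeats 0 in
/-- certificate check at order `255` (kernel evaluation) -/
theorem checkV_255 : checkV 255 = true := by
  decide +kernel

set_option maxHeartbeats 0 in
/-- certificate check at order `256` (kernel evaluation) -/
theorem checkV_256 : checkV 256 = true := by
  decide +kernel

set_option maxHeartbeats 0 in
/-- certificate check at order `257` (kernel evaluation) -/
theorem checkV_257 : checkV 257 = true := by
  decide +kernel

set_option maxHeartbeats 0 in
/-- certificate check at order `258` (kernel evaluation) -/
theorem checkV_258 : checkV 258 = true := by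
  decide +kernel

set_option maxHeartbeats 0 in
/-- certificate check at order `259` (kernel evaluation) -/
theorem checkV_259 : checkV 259 = true := by
  decide +kernel

set_option maxHeartbeats 0 in
/-- certificate check at order `260` (kernel evaluation) -/
theorem checkV_260 : checkV 260 = true := by
  decide +kernel

set_option maxHeartbeats 0 in
/-- certificate check at order `261` (kernel evaluation) -/
theorem checkV_261 : checkV 261 = true := by
  decide +kernel

set_option maxHeartbeats 0 in
/-- certificate check at order `262` (kernel evaluation) -/
theorem checkV_262 : checkV 262 = true := by
  decide +kernel

set_option maxHeartbeats 0 in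
/-- certificate check at order `263` (kernel evaluation) -/
theorem checkV_263 : checkV 263 = true := by
  decide +kernel

set_option maxHeartbeats 0 in
/-- certificate check at order `264` (kernel evaluation) -/
theorem checkV_264 : checkV 264 = true := by
  decide +kernel

set_option maxHeartbeats 0 in
/-- certificate check at order `265` (kernel evaluation) -/
theorem checkV_265 : checkV 265 = true := by
  decide +kernel

set_option maxHeartbeats 0 in
/-- certificate check at order `266` (kernel evaluation) -/
theorem checkV_266 : checkV 266 = true := by
  decide +kernel

set_option maxHeartbeats 0 in
/-- certificate check at order `267` (kernel evaluation) -/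
theorem checkV_267 : checkV 267 = true := by
  decide +kernel

set_option maxHeartbeats 0 in
/-- certificate check at order `268` (kernel evaluation) -/
theorem checkV_268 : checkV 268 = true := by
  decide +kernel

set_option maxHeartbeats 0 in
/-- certificate check at order `269` (kernel evaluation) -/
theorem checkV_269 : checkV 269 = true := by
  decide +kernel

set_option maxHeartbeats 0 in
/-- certificate check at order `270` (kernel evaluation) -/
theorem checkV_270 : checkV 270 = true := by
  decide +kernel

set_option maxHeartbeats 0 in
/-- certificate check at order `271` (kernel evaluation) -/
theorem checkV_271 : checkV 271 = true := by
  decide +kernel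

set_option maxHeartbeats 0 in
/-- certificate check at order `272` (kernel evaluation) -/
theorem checkV_272 : checkV 272 = true := by
  decide +kernel

set_option maxHeartbeats 0 in
/-- certificate check at order `273` (kernel evaluation) -/
theorem checkV_273 : checkV 273 = true := by
  decide +kernel

set_option maxHeartbeats 0 in
/-- certificate check at order `274` (kernel evaluation) -/
theorem checkV_274 : checkV 274 = true := by
  decide +kernel

set_option maxHeartbeats 0 in
/-- certificate check at order `275` (kernel evaluation) -/
theorem checkV_275 : checkV 275 = true := by
  decide +kernel

set_option maxHeartbeats 0 in
/-- certificate check at order `276` (kernel evaluation) -/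
theorem checkV_276 : checkV 276 = true := by
  decide +kernel

set_option maxHeartbeats 0 in
/-- certificate check at order `277` (kernel evaluation) -/
theorem checkV_277 : checkV 277 = true := by
  decide +kernel

set_option maxHeartbeats 0 in
/-- certificate check at order `278` (kernel evaluation) -/
theorem checkV_278 : checkV 278 = true := by
  decide +kernel

set_option maxHeartbeats 0 in
/-- certificate check at order `279` (kernel evaluation) -/
theorem checkV_279 : checkV 279 = true := by
  decide +kernel

/-- **The vP certificate holds at every order `255 ≤ M ≤ 279`** (collects the evaluations of this file). -/
theorem checkV_255_279 (M : ℕ) (h₁ : 255 ≤ M) (h₂ : M ≤ 279) : checkV M = true := by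
  interval_cases M
  · exact checkV_255
  · exact checkV_256
  · exact checkV_257
  · exact checkV_258
  · exact checkV_259
  · exact checkV_260
  · exact checkV_261
  · exact checkV_262
  · exact checkV_263
  · exact checkV_264
  · exact checkV_265
  · exact checkV_266
  · exact checkV_267
  · exact checkV_268
  · exact checkV_269
  · exact checkV_270
  · exact checkV_271
  · exact checkV_272
  · exact checkV_273
  · exact checkV_274
  · exact checkV_275
  · exact checkV_276
  · exact checkV_277
  · exact checkV_278
  · exact checkV_279

end Summit.MatrixMultiplication.MatrixMultiplication.Theorems.ShapeCertVP
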